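import Mathlib
import Summits.Ventures.PercRepro2.Defs
import Summits.Ventures.PercRepro2.Graph
import Summits.Ventures.PercRepro2.OneColourSwitch
import Summits.Ventures.PercRepro2.RegionHubSign
import Summits.Ventures.PercRepro2.SideSwitch
import Summits.Ventures.PercRepro2.SideSwitchFibre
import Summits.Ventures.PercRepro2.SideSwitchMono
import Summits.Ventures.PercRepro2.SideSwitchM9
import Summits.Ventures.PercRepro2.SideSwitchClosed
import Summits.Ventures.PercRepro2.SideSwitchComps
import Summits.Ventures.PercRepro2.SideSwitchCompsFibre
import Summits.Ventures.PercRepro2.M9LatticeHarrisGen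
import Summits.Ventures.PercRepro2.M9LatticeHarrisSub
import Summits.Ventures.PercRepro2.M9NoPocketDefs
import Summits.Ventures.PercRepro2.M9NoPocketHarris
import Summits.Ventures.PercRepro2.M9NoPocketSetDefs
import Summits.Ventures.PercRepro2.M9NoPocketSetWorld
import Summits.Ventures.PercRepro2.M9NoPocketSetWorldD
import Summits.Ventures.PercRepro2.M9NoPocketSetLegal
import Summits.Ventures.PercRepro2.M9NoPocketSetCompl

/-!
# The multi-`d` class without pockets — the lattice of legal vectors (blind cell PercRepro2,
p3 g20, 2026-08-27; `proofs/P3-CPNC.md` §17i (2)); the multi-`d` form of `M9NoPocketHarris`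
(whose Harris lemma `sum_sub_dual_mul_nonpos_of_sublattice''` is reused)

The legal vectors form a sublattice of `Finset (Finset V) × Finset E` closed under the dual
`cdual` (`L4_sup_mem`, `L4_inf_mem`, `cdual_mem_L4`; the dual is an involution on the box and
antitone), and Harris on a self-dual sublattice holds when the involution is only an involution
on the sublattice and the functions are only monotone / antitone there
(`sum_sub_dual_mul_nonpos_of_sublattice''`, the local form of `M9LatticeHarrisGen`, through the
projection of `M9LatticeHarrisSub`).  The theorem is `M9NoPocketM9`.  Own work; std axioms.
-/

namespace Summit.Ventures.PercRepro2

namespace NoPocketSet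

open Finset Classical RegionHub OneColourSwitch SideSwitch M9Reduce NoPocket

variable {V : Type*} {E : Type*}


section Lattice

variable [Fintype V] [DecidableEq V] [Fintype E] [DecidableEq E]

variable {ends : E → Sym2 V}

omit [Fintype V] [Fintype E] in
/-- The components of a sup of vectors. -/
lemma sup_fst_snd (x x' : Finset (Finset V) × Finset E) :
    (x ⊔ x').1 = x.1 ∪ x'.1 ∧ (x ⊔ x').2 = x.2 ∪ x'.2 := ⟨rfl, rfl⟩

omit [Fintype V] [Fintype E] in
/-- The components of an inf of vectors. -/
lemma inf_fst_snd (x x' : Finset (Finset V) × Finset E) :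
    (x ⊓ x').1 = x.1 ∩ x'.1 ∧ (x ⊓ x').2 = x.2 ∩ x'.2 := ⟨rfl, rfl⟩

/-- The legal vectors are closed under `⊔`. -/
lemma L4_sup_mem {D : Finset V} {r s : V} {ρ : Config E} {x x' : Finset (Finset V) × Finset E}
    (hx : x ∈ L4 ends D r s ρ) (hx' : x' ∈ L4 ends D r s ρ) : x ⊔ x' ∈ L4 ends D r s ρ := by
  obtain ⟨⟨hT, hF⟩, hL⟩ := mem_L4.1 hx
  obtain ⟨⟨hT', hF'⟩, hL'⟩ := mem_L4.1 hx'
  obtain ⟨e1, e2⟩ := sup_fst_snd x x'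
  rw [mem_L4, e1, e2]
  refine ⟨⟨Finset.union_subset hT hT', Finset.union_subset hF hF'⟩, fun d hd => ⟨?_, ?_⟩⟩
  · obtain ⟨hW, _⟩ := hL d hd
    obtain ⟨hW', _⟩ := hL' d hd
    intro hsrc C hC hCx
    have hsrc' : srcW ends d r s ρ x ∨ srcW ends d r s ρ x' := by
      rcases hsrc with ⟨e, he, heT⟩ | ⟨C', hC', hY'⟩
      · rcases Finset.mem_union.1 he with h | h
        · exact Or.inl (Or.inl ⟨e, h, heT⟩)
        · exact Or.inr (Or.inl ⟨e, h, heT⟩)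
      · rcases Finset.mem_union.1 hC' with h | h
        · exact Or.inl (Or.inr ⟨C', h, hY'⟩)
        · exact Or.inr (Or.inr ⟨C', h, hY'⟩)
    rcases hsrc' with h | h
    · exact hW h C hC (fun h' => hCx (Finset.mem_union_left _ h'))
    · exact hW' h C hC (fun h' => hCx (Finset.mem_union_right _ h'))
  · obtain ⟨_, hY⟩ := hL d hd
    obtain ⟨_, hY'⟩ := hL' d hd
    intro hsrc C hCx
    have hsrc' : srcY ends D d r s ρ x ∧ srcY ends D d r s ρ x' := by
      rcases hsrc with ⟨e, heT, he⟩ | ⟨C', hC', hC'x, hY'⟩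
      · exact ⟨Or.inl ⟨e, heT, fun h => he (Finset.mem_union_left _ h)⟩,
          Or.inl ⟨e, heT, fun h => he (Finset.mem_union_right _ h)⟩⟩
      · exact ⟨Or.inr ⟨C', hC', fun h => hC'x (Finset.mem_union_left _ h), hY'⟩,
          Or.inr ⟨C', hC', fun h => hC'x (Finset.mem_union_right _ h), hY'⟩⟩
    rcases Finset.mem_union.1 hCx with h | h
    · exact hY hsrc'.1 C h
    · exact hY' hsrc'.2 C h

/-- The legal vectors are closed under `⊓`. -/
lemma L4_inf_mem {D : Finset V} {r s : V} {ρ : Config E} {x x' : Finset (Finset V) × Finset E}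
    (hx : x ∈ L4 ends D r s ρ) (hx' : x' ∈ L4 ends D r s ρ) : x ⊓ x' ∈ L4 ends D r s ρ := by
  obtain ⟨⟨hT, hF⟩, hL⟩ := mem_L4.1 hx
  obtain ⟨⟨hT', hF'⟩, hL'⟩ := mem_L4.1 hx'
  obtain ⟨e1, e2⟩ := inf_fst_snd x x'
  rw [mem_L4, e1, e2]
  refine ⟨⟨Finset.inter_subset_left.trans hT, Finset.inter_subset_left.trans hF⟩,
    fun d hd => ⟨?_, ?_⟩⟩
  · obtain ⟨hW, _⟩ := hL d hd
    obtain ⟨hW', _⟩ := hL' d hd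
    intro hsrc C hC hCx
    have hsrc' : srcW ends d r s ρ x ∧ srcW ends d r s ρ x' := by
      rcases hsrc with ⟨e, he, heT⟩ | ⟨C', hC', hY''⟩
      · obtain ⟨h1, h2⟩ := Finset.mem_inter.1 he
        exact ⟨Or.inl ⟨e, h1, heT⟩, Or.inl ⟨e, h2, heT⟩⟩
      · obtain ⟨h1, h2⟩ := Finset.mem_inter.1 hC'
        exact ⟨Or.inr ⟨C', h1, hY''⟩, Or.inr ⟨C', h2, hY''⟩⟩
    by_cases h : C ∈ x.1
    · have h' : C ∉ x'.1 := fun h' => hCx (Finset.mem_inter.2 ⟨h, h'⟩)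
      exact hW' hsrc'.2 C hC h'
    · exact hW hsrc'.1 C hC h
  · obtain ⟨_, hY⟩ := hL d hd
    obtain ⟨_, hY'⟩ := hL' d hd
    intro hsrc C hCx
    obtain ⟨h1, h2⟩ := Finset.mem_inter.1 hCx
    have hsrc' : srcY ends D d r s ρ x ∨ srcY ends D d r s ρ x' := by
      rcases hsrc with ⟨e, heT, he⟩ | ⟨C', hC', hC'x, hY''⟩
      · by_cases h : e ∈ x.2
        · exact Or.inr (Or.inl ⟨e, heT, fun h' => he (Finset.mem_inter.2 ⟨h, h'⟩)⟩)
        · exact Or.inl (Or.inl ⟨e, heT, h⟩)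
      · by_cases h : C' ∈ x.1
        · exact Or.inr (Or.inr ⟨C', hC', fun h' => hC'x (Finset.mem_inter.2 ⟨h, h'⟩), hY''⟩)
        · exact Or.inl (Or.inr ⟨C', hC', h, hY''⟩)
    rcases hsrc' with h | h
    · exact hY h C h1
    · exact hY' h C h2

/-- The dual vector of a legal vector is legal. -/
lemma cdual_mem_L4 {D : Finset V} {r s : V} {ρ : Config E} {x : Finset (Finset V) × Finset E}
    (hx : x ∈ L4 ends D r s ρ) : cdual ends D r s ρ x ∈ L4 ends D r s ρ := by
  obtain ⟨⟨hT, hF⟩, hL⟩ := mem_L4.1 hx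
  rw [mem_L4]
  refine ⟨⟨Finset.sdiff_subset, Finset.sdiff_subset⟩, fun d hd => ⟨?_, ?_⟩⟩
  · -- a `W`-source of the dual is a `Y`-source of `x`
    obtain ⟨_, hY⟩ := hL d hd
    intro hsrc C hC hCx
    have hsrc' : srcY ends D d r s ρ x := by
      rcases hsrc with ⟨e, he, heT⟩ | ⟨C', hC', hY'⟩
      · exact Or.inl ⟨e, heT, (Finset.mem_sdiff.1 he).2⟩
      · obtain ⟨h1, h2⟩ := Finset.mem_sdiff.1 hC'
        exact Or.inr ⟨C', h1, h2, hY'⟩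
    have hCx' : C ∈ x.1 := by
      by_contra h
      exact hCx (Finset.mem_sdiff.2 ⟨hC, h⟩)
    exact hY hsrc' C hCx'
  · -- a `Y`-source of the dual is a `W`-source of `x`
    obtain ⟨hW, _⟩ := hL d hd
    intro hsrc C hCx
    obtain ⟨hC, hCx'⟩ := Finset.mem_sdiff.1 hCx
    have hsrc' : srcW ends d r s ρ x := by
      rcases hsrc with ⟨e, heT, he⟩ | ⟨C', hC', hC'x, hY'⟩
      · by_contra h
        exact he (Finset.mem_sdiff.2 ⟨TsetAt_subset_Tset hd heT, fun h' => h (Or.inl ⟨e, h', heT⟩)⟩)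
      · by_contra h
        exact hC'x (Finset.mem_sdiff.2 ⟨hC', fun h' => h (Or.inr ⟨C', h', hY'⟩)⟩)
    exact hW hsrc' C hC hCx'

/-- The dual is an involution on the vectors inside the ground pair. -/
lemma cdual_cdual {D : Finset V} {r s : V} {ρ : Config E} {x : Finset (Finset V) × Finset E}
    (hT : x.1 ⊆ blocks ends D r s ρ) (hF : x.2 ⊆ Tset ends D r s) :
    cdual ends D r s ρ (cdual ends D r s ρ x) = x := by
  simp only [cdual]
  rw [Finset.sdiff_sdiff_eq_self hT, Finset.sdiff_sdiff_eq_self hF]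

/-- The dual is antitone. -/
lemma cdual_antitone {D : Finset V} {r s : V} (ρ : Config E) : Antitone (cdual ends D r s ρ) := by
  intro x x' hxx'
  obtain ⟨h1, h2⟩ := Prod.le_def.1 hxx'
  refine Prod.le_def.2 ⟨?_, ?_⟩
  · exact Finset.sdiff_subset_sdiff (Finset.Subset.refl _) h1
  · exact Finset.sdiff_subset_sdiff (Finset.Subset.refl _) h2

/-- The dual with respect to the outside-flipped representative is the dual. -/
lemma cdual_flipOp {D : Finset V} {r s : V} (ρ : Config E)
    (x : Finset (Finset V) × Finset E) :
    cdual ends D r s (flipOp ends D r s ρ) x = cdual ends D r s ρ x := by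
  simp only [cdual, blocks_flipOp]

end Lattice

end NoPocketSet

end Summit.Ventures.PercRepro2
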